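import Summits.BirchSwinnertonDyer.Rank1Residual.Additive.X4RankOneKimKatoConsistencyGap
import Summits.BirchSwinnertonDyer.Rank1Residual.Additive.X4RankOneKimKatoConsistencyPotMult
import Summits.BirchSwinnertonDyer.Rank1Residual.AdditivePotMult.PotMultBranchPAdicValIdentityRouteG
import Summits.BirchSwinnertonDyer.Rank1Residual.Additive.SemistableTwistTowerThree
import Summits.BirchSwinnertonDyer.Rank1Residual.Additive.CensusQ6CoeffValuation
import HarnessLib

/-!
# X4(M) ∧ `r_an = 1` at INDEX `n₀`: the Kurihara `∂`-gap on the potentially MULTIPLICATIVE budget rows —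
# `∂^{(1)} − ∂^{(∞)} + v(Reg_p) + ord_p ∏c = v_p(c₁(ϖB)) + 1 + 2·ord_p #E(ℚ)_tors` (cell `b2b-bsdres`,
# team n1011, seat p17 gen 2, PROPOSED row T-KK-BUD FILE 2; the (M) twin of
# `X4RankOneKimKatoConsistencyBudget.lean` over n1011-p07's T-E3gM `v₁`-identity
# `PotMultBranchPAdicValIdentityRouteG.lean` (`…_of_firstUnitIndex_of_budget`); index `1` = p257102)

HONEST FRAMING (cell `b2b-bsdres`, run/shared/lean/b2b/bsd-rank1-residual/, verbatim in every
file): the goal of the cell is to DELETE the COMBINATION-SHAPED residual classes of the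
Birch–Swinnerton-Dyer formula for ALL analytic-rank `≤ 1` elliptic curves over `ℚ` — "full BSD
formula for every rank `≤ 1` curve in class `C`" assembled STRICTLY from published theorems — so
that the rank-`≤ 1` remainder becomes exactly the CONSTRUCTION-SHAPED classes, which are TYPED
(missing-input `Prop`s), NOT attempted. This is not "finishing BSD". Team n1011: prove what is
provable now; shrink each hard class to its core with data; no claim beyond stated classes;
research routes; census output = EVIDENCE / conjecture items, never a Literature fact; RESIDUAL-MAP
marks change only by signed lines. X4(M) stays CONSTRUCTION-SHAPED; §I O7 stays OPEN; nothing here is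
booked. Theorems only (NO definition, NO Literature fact, NO `_holds`); every published input (`hE73`
= Kim's clause (6) AS PRINTED at `p ≥ 5`, flag `Kim2026-(6)-cyclic-reading`; `hKato` = Kato 17.4 (3)
half-eigen reading), every conjecture (at `p = 3`: OUR `X4SharpThreeKimRankOnePartial`) and every
certificate (the census Q6 record at index `n₀`: `CensusQ6.Mult[Odd]FirstUnitIndexAt W p n₀`; the
budget `BudgetLeLambdaAt p W n₀`; the Kurihara witness `∂^{(1)} ≠ ∞` — all EVIDENCE) is an explicit
hypothesis. `#print axioms` standard.

COVERAGE (stated first, referee 1 proviso): per pair, `W/ℚ` globally minimal, `ClassX4M W p`,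
`ρ̄_{E,p}` onto, `ord_{s=1} L(E,s) = 1`; a multiplicative twist model `C • V^{(p*)} = W` with newform `f`,
`a_p(f) = ap`, period ratio `ϖ` of the parity and `c₁(ϖ·L_p^±(f, ap, ω^{(p−1)/2}, T)) ≠ 0`; §1 `p ≥ 5`,
§2 `p = 3`, §3 tower-free re-export of p257102 §1; + the CENSUS-LITERAL form
`…_of_multCoeffValAt_of_budget_of_five_le` (column `v1` = census-ctyper1's `CensusQ6.MultCoeffValAt W p 1 v₁`,
twist datum DISCHARGED). NO `ℓ` (ℓ_p = 1 on (M)), NO tower binder (`ClassX4M.towerSurj_of_surj`), NO `5 ≤ p` at 3,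
NO CM / Pal / hna. KURREG reading: the `B ≥ 2` (M) rows (1 982 of the 2 955 K1-M rows, §9 A3) with the
Q6 record at `n₀` and the budget; column `v1`.

References: [Kim2022StructureSelmer] Thm. 1.9 (6), Conj. 1.10 (PDF p. 8); [Kato2004Asterisque] Thm. 17.4
(3) (p. 273); [Delbourgo2002] Thm. (B) (p. 40), ℓ_p = 1 (p. 39); [EmertonPollackWeston2006] Cor. 3.2.5
(budget shape); [GreenbergLNM1716] §3 Lemma 3.1.
-/

noncomputable section

open scoped Classical MatrixGroups ModularForm NumberField

namespace Summit.BirchSwinnertonDyer.Rank1Residual.AdditivePotMult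

open CongruenceSubgroup WeierstrassCurve NumberField Literature.NumberTheory.EllipticCurves
  Literature.NumberTheory.EllipticCurves.ModularForms
  Literature.NumberTheory.EllipticCurves.Rank1Residual
  Literature.NumberTheory.EllipticCurves.Rank1Residual.Typed
  Literature.NumberTheory.EllipticCurves.Delbourgo2002
  Literature.NumberTheory.GaloisRepresentations Summit.BirchSwinnertonDyer.Rank1Residual.Additive
  IsDedekindDomain

/-! ## §1 `p ≥ 5`, index `n₀` on (M): NO conjecture, tower discharged -/

section FiveLe

variable {W : WeierstrassCurve ℚ} [W.IsElliptic] [W.IsGloballyMinimal] {p : ℕ} [hp : Fact p.Prime]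

/-- **X4(M) ∩ {`ρ̄` onto}, `p ≥ 5`, `r_an = 1`, Q6 record at index `n₀` + budget `n₀ ≤ λ`, multiplicative
twist datum with `c₁(ϖB) ≠ 0`, (B)-datum, parametrisation datum, ONE non-zero Kurihara number:
`∂^{(1)}(δ̃) − ∂^{(∞)}(δ̃) + v(Reg_p(E,Dh)) + ord_p ∏c = v_p(c₁(ϖB)) + 1 + 2·ord_p #E(ℚ)_tors`** — modulo the
PUBLISHED facts `hE73`, `hKato`, GZK, modularity and the certificates; NO conjecture; NO `ℓ` on (M); the
Serre tower DISCHARGED (`ClassX4M.towerSurj_of_surj`). Over p07's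
`ClassX4M.schneider_and_padicVal_identity_rankOne_of_katoHalf_of_firstUnitIndex_of_budget` BY NAME.
Per pair; nothing booked. [cite: Kim2022StructureSelmer, Thm. 1.9 (6) (PDF p. 8)]
[cite: Kato2004Asterisque, Thm. 17.4 (3) (p. 273)] [cite: Delbourgo2002, Theorem (B) (p. 40)]
[cite: EmertonPollackWeston2006, Cor. 3.2.5 (budget shape)] -/
theorem ClassX4M.kuriharaGap_identity_rankOne_of_kim2026_of_katoHalf_of_firstUnitIndex_of_budget_of_five_le
    (hE73 : Kim2026.kuriharaPartial_vanishingOrder_eq_padicValNat_sha_add_partialInfty_of_maninConstant)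
    (hKato : Wuthrich2014.kato_halfEigenCharIdeal_dvd_cyclotomicPrime_of_surjective)
    (hGZK : rank_eq_analyticRank_of_analyticRank_le_one) (hmod : hasEntireLFunction_rat)
    (hX : ClassX4M W p) (hp5 : 5 ≤ p) (hsurj : Surj W p) (hr : W.analyticRank = 1) {n₀ : ℕ}
    (hrec : (p % 4 = 1 → CensusQ6.MultFirstUnitIndexAt W p n₀) ∧
      (p % 4 = 3 → CensusQ6.MultOddFirstUnitIndexAt W p n₀))
    (hbud : BudgetLeLambdaAt p W n₀)
    (V : WeierstrassCurve ℚ) [V.IsElliptic] [V.IsGloballyMinimal] (C : VariableChange ℚ)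
    (hV : Mult V p) (hC : C • V.quadraticTwist ((-1 : ℚ) ^ (p / 2) * p) = W)
    {N₁ : ℕ} [NeZero N₁] {f : CuspForm (Gamma0 N₁) 2} (hf : IsNewformOf V f) (ap : ℤ)
    (hap : cuspCoeff f p = ap) (ϖ : ℚ)
    (hϖ : if Even (p / 2) then (ϖ : ℝ) * V.realPeriodRat = plusPeriod f
      else (ϖ : ℝ) * V.imaginaryPeriodRat = minusPeriod f)
    (hne₁ : PowerSeries.coeff 1 (PowerSeries.C (ϖ : ℚ_[p]) *
      (if Even (p / 2) then padicLFunctionPlusBranchMult f (ap : ℚ_[p]) (p / 2)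
        else padicLFunctionMinusBranchMult f (ap : ℚ_[p]) (p / 2))) ≠ 0)
    {Dh : PAdicHeightData W p} (hB : LeadingTermClauses W p Dh)
    {N : ℕ} [NeZero N] (D : ModularParametrizationData W N) (hc : ¬ (p : ℤ) ∣ D.maninConstant)
    (hper : ∃ u : ℚ, ‖(u : ℚ_[p])‖ = 1 ∧ W.realPeriodRat = u * plusPeriod D.f)
    (hne : kuriharaPartial W p D.f 1 ≠ ⊤) :
    ∃ m d : ℕ, kuriharaPartial W p D.f 1 = m ∧ kuriharaPartialInfty W p D.f = d ∧
      (m : ℤ) - d + (padicRegulator Dh).valuation + padicValNat p W.tamagawaProduct =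
        (PowerSeries.coeff 1 (PowerSeries.C (ϖ : ℚ_[p]) *
            (if Even (p / 2) then padicLFunctionPlusBranchMult f (ap : ℚ_[p]) (p / 2)
              else padicLFunctionMinusBranchMult f (ap : ℚ_[p]) (p / 2)))).valuation +
          1 + 2 * padicValNat p W.torsionOrder := by
  have hr1 : W.analyticRank ≤ 1 := by rw [hr]
  have hL : W.entireLFunction 1 = 0 := by
    by_contra hne'
    have h0 := (W.analyticRank_eq_zero_iff_holds (hmod W)).mpr hne'
    omega
  have hfin : Finite W.sha := (hGZK W hr1).2
  have hid := padicValNat_shaOrder_add_partialInfty_eq_of_kimRankOnePartialAt W p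
    (kimRankOnePartialAt_of_kim2026_of_five_le W p hE73 hp5) hsurj (hX.towerSurj_of_surj hsurj) hL hr hfin
    D hc hper hne
  obtain ⟨-, hidK⟩ :=
    hX.schneider_and_padicVal_identity_rankOne_of_katoHalf_of_firstUnitIndex_of_budget hKato hGZK hsurj hr
      hrec hbud V C hV hC hf ap hap ϖ hϖ hne₁ hB
  obtain ⟨d, hd⟩ := ENat.ne_top_iff_exists.mp
    (kuriharaPartialInfty_ne_top_of_kuriharaPartial_one_ne_top W p D.f hne)
  refine ⟨padicValNat p W.shaOrder + d, d, ?_, hd.symm, ?_⟩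
  · rw [← hid, ← hd]
    push_cast
    rfl
  · rw [Nat.cast_add]
    linarith

/-- **With Kim's Conjecture 1.10 at the pair** (`hT : ∂^{(∞)} = ord_p ∏c`), `p ≥ 5`, X4(M), index `n₀`:
**`∂^{(1)}(δ̃) + v(Reg_p(E,Dh)) = v_p(c₁(ϖB)) + 1`** (`p ∤ #E(ℚ)_tors`). Per pair; nothing booked.
[cite: Kim2022StructureSelmer, Thm. 1.9 (6), Conj. 1.10 (PDF p. 8)] [cite: Kato2004Asterisque, Thm. 17.4 (3) (p. 273)]
[cite: Delbourgo2002, Theorem (B) (p. 40)] -/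
theorem ClassX4M.kuriharaPartial_one_identity_rankOne_of_kim2026_of_tamagawaDefect_of_firstUnitIndex_of_budget_of_five_le
    (hE73 : Kim2026.kuriharaPartial_vanishingOrder_eq_padicValNat_sha_add_partialInfty_of_maninConstant)
    (hKato : Wuthrich2014.kato_halfEigenCharIdeal_dvd_cyclotomicPrime_of_surjective)
    (hGZK : rank_eq_analyticRank_of_analyticRank_le_one) (hmod : hasEntireLFunction_rat)
    (hX : ClassX4M W p) (hp5 : 5 ≤ p) (hsurj : Surj W p) (hr : W.analyticRank = 1) {n₀ : ℕ}
    (hrec : (p % 4 = 1 → CensusQ6.MultFirstUnitIndexAt W p n₀) ∧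
      (p % 4 = 3 → CensusQ6.MultOddFirstUnitIndexAt W p n₀))
    (hbud : BudgetLeLambdaAt p W n₀)
    (V : WeierstrassCurve ℚ) [V.IsElliptic] [V.IsGloballyMinimal] (C : VariableChange ℚ)
    (hV : Mult V p) (hC : C • V.quadraticTwist ((-1 : ℚ) ^ (p / 2) * p) = W)
    {N₁ : ℕ} [NeZero N₁] {f : CuspForm (Gamma0 N₁) 2} (hf : IsNewformOf V f) (ap : ℤ)
    (hap : cuspCoeff f p = ap) (ϖ : ℚ)
    (hϖ : if Even (p / 2) then (ϖ : ℝ) * V.realPeriodRat = plusPeriod f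
      else (ϖ : ℝ) * V.imaginaryPeriodRat = minusPeriod f)
    (hne₁ : PowerSeries.coeff 1 (PowerSeries.C (ϖ : ℚ_[p]) *
      (if Even (p / 2) then padicLFunctionPlusBranchMult f (ap : ℚ_[p]) (p / 2)
        else padicLFunctionMinusBranchMult f (ap : ℚ_[p]) (p / 2))) ≠ 0)
    {Dh : PAdicHeightData W p} (hB : LeadingTermClauses W p Dh)
    {N : ℕ} [NeZero N] (D : ModularParametrizationData W N) (hc : ¬ (p : ℤ) ∣ D.maninConstant)
    (hper : ∃ u : ℚ, ‖(u : ℚ_[p])‖ = 1 ∧ W.realPeriodRat = u * plusPeriod D.f)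
    (hne : kuriharaPartial W p D.f 1 ≠ ⊤) (hT : X4.KimTamagawaDefectAt W p D.f) :
    ∃ m : ℕ, kuriharaPartial W p D.f 1 = m ∧
      (m : ℤ) + (padicRegulator Dh).valuation =
        (PowerSeries.coeff 1 (PowerSeries.C (ϖ : ℚ_[p]) *
            (if Even (p / 2) then padicLFunctionPlusBranchMult f (ap : ℚ_[p]) (p / 2)
              else padicLFunctionMinusBranchMult f (ap : ℚ_[p]) (p / 2)))).valuation + 1 := by
  obtain ⟨m, d, hm, hd, hid⟩ :=
    hX.kuriharaGap_identity_rankOne_of_kim2026_of_katoHalf_of_firstUnitIndex_of_budget_of_five_le hE73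
      hKato hGZK hmod hp5 hsurj hr hrec hbud V C hV hC hf ap hap ϖ hϖ hne₁ hB D hc hper hne
  have htors0 : padicValNat p W.torsionOrder = 0 :=
    padicValNat_torsionOrder_eq_zero_of_irreducible W p hX.classX4.2.2
  unfold X4.KimTamagawaDefectAt at hT
  have hdT : (d : ℕ∞) = (padicValNat p W.tamagawaProduct : ℕ∞) := hd.symm.trans hT
  have hdT' : d = padicValNat p W.tamagawaProduct := by exact_mod_cast hdT
  refine ⟨m, hm, ?_⟩
  rw [htors0, hdT'] at hid
  simp only [Nat.cast_zero, mul_zero, add_zero] at hid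
  linarith

/-- **CENSUS-LITERAL form of §1 on (M)** (the KURREG K1-M-n₀ / K0-n₀ row shape): X4(M) ∩ {`ρ̄` onto},
`p ≥ 5`, `r_an = 1`, Q6 record at index `n₀` + budget `n₀ ≤ λ` + the (M) VALUATION RECORD at index `1`
`CensusQ6.MultCoeffValAt W p 1 v₁` (column `v1`; census-ctyper1) — the multiplicative twist datum is
DISCHARGED (`ClassX4M.exists_mult_pStar_twist_model`, `hmodD`, `a_p(f) = ±1` by the reduction sign):
**`∂^{(1)} − ∂^{(∞)} + v(Reg_p(E,Dh)) + ord_p ∏c = v₁ + 1 + 2·ord_p #E(ℚ)_tors`**, `v₁ ∈ ℤ` a census integer.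
NO conjecture; per pair; nothing booked. [cite: Kim2022StructureSelmer, Thm. 1.9 (6) (PDF p. 8)]
[cite: Kato2004Asterisque, Thm. 17.4 (3) (p. 273)] [cite: Delbourgo2002, Theorem (B) (p. 40)]
[cite: MazurTateTeitelbaum1986Invent, §I.10, §I.13 (the record; nothing asserted)] -/
theorem ClassX4M.kuriharaGap_identity_rankOne_of_kim2026_of_katoHalf_of_multCoeffValAt_of_budget_of_five_le
    (hE73 : Kim2026.kuriharaPartial_vanishingOrder_eq_padicValNat_sha_add_partialInfty_of_maninConstant)
    (hKato : Wuthrich2014.kato_halfEigenCharIdeal_dvd_cyclotomicPrime_of_surjective)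
    (hmodD : nonempty_modularParametrizationData)
    (hGZK : rank_eq_analyticRank_of_analyticRank_le_one) (hmod : hasEntireLFunction_rat)
    (hX : ClassX4M W p) (hp5 : 5 ≤ p) (hsurj : Surj W p) (hr : W.analyticRank = 1) {n₀ : ℕ}
    (hrec : (p % 4 = 1 → CensusQ6.MultFirstUnitIndexAt W p n₀) ∧
      (p % 4 = 3 → CensusQ6.MultOddFirstUnitIndexAt W p n₀))
    (hbud : BudgetLeLambdaAt p W n₀) {v₁ : ℤ} (hv1 : CensusQ6.MultCoeffValAt W p 1 v₁)
    {Dh : PAdicHeightData W p} (hB : LeadingTermClauses W p Dh)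
    {N : ℕ} [NeZero N] (D : ModularParametrizationData W N) (hc : ¬ (p : ℤ) ∣ D.maninConstant)
    (hper : ∃ u : ℚ, ‖(u : ℚ_[p])‖ = 1 ∧ W.realPeriodRat = u * plusPeriod D.f)
    (hne : kuriharaPartial W p D.f 1 ≠ ⊤) :
    ∃ m d : ℕ, kuriharaPartial W p D.f 1 = m ∧ kuriharaPartialInfty W p D.f = d ∧
      (m : ℤ) - d + (padicRegulator Dh).valuation + padicValNat p W.tamagawaProduct =
        v₁ + 1 + 2 * padicValNat p W.torsionOrder := by
  obtain ⟨V, iV, iVm, C, hV, hC⟩ := hX.exists_mult_pStar_twist_model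
  haveI : NeZero (V.conductorNorm ℤ) := ⟨(V.conductorNorm_pos_holds).ne'⟩
  obtain ⟨Dm⟩ := hmodD V
  obtain ⟨ϖ, hϖ⟩ := exists_periodRatio_parity (p := p) V Dm
  -- `a_p(E♭) = ±1` by the reduction sign
  obtain ⟨ap, hap⟩ : ∃ ap : ℤ, cuspCoeff Dm.f p = ap := by
    by_cases hs : V.HasSplitMultiplicativeReductionAtPrime p
    · exact ⟨1, by exact_mod_cast (Dm.isNewformOf.cuspCoeff_eq_one_and_sq_of_split hs).1⟩
    · exact ⟨-1, by exact_mod_cast (Dm.isNewformOf.cuspCoeff_eq_neg_one_and_dvd_of_nonsplit hV hs).1⟩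
  obtain ⟨hne₁, hval⟩ := hv1.coeff_ne_zero_and_valuation_eq V C hV hC Dm.f Dm.isNewformOf ap hap ϖ hϖ
  obtain ⟨m, d, hm, hd, hid⟩ :=
    hX.kuriharaGap_identity_rankOne_of_kim2026_of_katoHalf_of_firstUnitIndex_of_budget_of_five_le hE73
      hKato hGZK hmod hp5 hsurj hr hrec hbud V C hV hC Dm.isNewformOf ap hap ϖ hϖ hne₁ hB D hc hper hne
  refine ⟨m, d, hm, hd, ?_⟩
  rw [hval] at hid
  exact hid

end FiveLe

/-! ## §2 `p = 3`, index `n₀` on (M): modulo OUR `∂`-clause conjecture -/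

section Three

variable {W : WeierstrassCurve ℚ} [W.IsElliptic] [W.IsGloballyMinimal] [hp : Fact (Nat.Prime 3)]

/-- **X4(M)@3 ∩ {`ρ̄₃` onto}, `r_an = 1`, Q6 ODD record at index `n₀` (`CensusQ6.MultOddFirstUnitIndexAt W 3 n₀`)
+ budget at `3`, multiplicative twist datum with `c₁(ϖ·L₃⁻(f, a₃, ω, T)) ≠ 0`, (B)-datum, parametrisation
datum, ONE non-zero Kurihara number: `∂^{(1)} − ∂^{(∞)} + v(Reg₃(E,Dh)) + ord₃ ∏c = v₃(c₁) + 1 + 2·ord₃ #E(ℚ)_tors`**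
— modulo OUR conjecture `X4SharpThreeKimRankOnePartial` + Kato 17.4 (3) + GZK + modularity + the
certificates; NO Conj. 1.10; tower by `ClassX4M.towerSurj_of_surj`. Per pair; nothing booked.
[cite: Kim2022StructureSelmer, Thm. 1.9 (6) (PDF p. 8)] [cite: Kato2004Asterisque, Thm. 17.4 (3) (p. 273)]
[cite: Delbourgo2002, Theorem (B) (p. 40)] -/
theorem ClassX4M.kuriharaGap_identity_three_rankOne_of_kimPartial_of_katoHalf_of_firstUnitIndex_of_budget
    (h3 : X4SharpThreeKimRankOnePartial)
    (hKato : Wuthrich2014.kato_halfEigenCharIdeal_dvd_cyclotomicPrime_of_surjective)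
    (hGZK : rank_eq_analyticRank_of_analyticRank_le_one) (hmod : hasEntireLFunction_rat)
    (hX : ClassX4M W 3) (hsurj : Surj W 3) (hr : W.analyticRank = 1) {n₀ : ℕ}
    (hrec : CensusQ6.MultOddFirstUnitIndexAt W 3 n₀) (hbud : BudgetLeLambdaAt 3 W n₀)
    (V : WeierstrassCurve ℚ) [V.IsElliptic] [V.IsGloballyMinimal] (C : VariableChange ℚ)
    (hV : Mult V 3) (hC : C • V.quadraticTwist ((-1 : ℚ) ^ (3 / 2) * (3 : ℕ)) = W)
    {N₁ : ℕ} [NeZero N₁] {f : CuspForm (Gamma0 N₁) 2} (hf : IsNewformOf V f) (ap : ℤ)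
    (hap : cuspCoeff f 3 = ap) (ϖ : ℚ)
    (hϖ : if Even (3 / 2) then (ϖ : ℝ) * V.realPeriodRat = plusPeriod f
      else (ϖ : ℝ) * V.imaginaryPeriodRat = minusPeriod f)
    (hne₁ : PowerSeries.coeff 1 (PowerSeries.C (ϖ : ℚ_[3]) *
      (if Even (3 / 2) then padicLFunctionPlusBranchMult f (ap : ℚ_[3]) (3 / 2)
        else padicLFunctionMinusBranchMult f (ap : ℚ_[3]) (3 / 2))) ≠ 0)
    {Dh : PAdicHeightData W 3} (hB : LeadingTermClauses W 3 Dh)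
    {N : ℕ} [NeZero N] (D : ModularParametrizationData W N) (hc : ¬ (3 : ℤ) ∣ D.maninConstant)
    (hper : ∃ u : ℚ, ‖(u : ℚ_[3])‖ = 1 ∧ W.realPeriodRat = u * plusPeriod D.f)
    (hne : kuriharaPartial W 3 D.f 1 ≠ ⊤) :
    ∃ m d : ℕ, kuriharaPartial W 3 D.f 1 = m ∧ kuriharaPartialInfty W 3 D.f = d ∧
      (m : ℤ) - d + (padicRegulator Dh).valuation + padicValNat 3 W.tamagawaProduct =
        (PowerSeries.coeff 1 (PowerSeries.C (ϖ : ℚ_[3]) *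
            (if Even (3 / 2) then padicLFunctionPlusBranchMult f (ap : ℚ_[3]) (3 / 2)
              else padicLFunctionMinusBranchMult f (ap : ℚ_[3]) (3 / 2)))).valuation +
          1 + 2 * padicValNat 3 W.torsionOrder := by
  have hr1 : W.analyticRank ≤ 1 := by rw [hr]
  have hL : W.entireLFunction 1 = 0 := by
    by_contra hne'
    have h0 := (W.analyticRank_eq_zero_iff_holds (hmod W)).mpr hne'
    omega
  have hfin : Finite W.sha := (hGZK W hr1).2
  have hid := padicValNat_shaOrder_add_partialInfty_eq_of_kimRankOnePartialAt W 3
    (kimRankOnePartialAt_three_of_classX4 W h3 hX.classX4) hsurj (hX.towerSurj_of_surj hsurj) hL hr hfin D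
    (by exact_mod_cast hc) hper hne
  have hrec' : (3 % 4 = 1 → CensusQ6.MultFirstUnitIndexAt W 3 n₀) ∧
      (3 % 4 = 3 → CensusQ6.MultOddFirstUnitIndexAt W 3 n₀) :=
    ⟨fun h ↦ absurd h (by decide), fun _ ↦ hrec⟩
  obtain ⟨-, hidK⟩ :=
    hX.schneider_and_padicVal_identity_rankOne_of_katoHalf_of_firstUnitIndex_of_budget hKato hGZK hsurj hr
      hrec' hbud V C hV hC hf ap hap ϖ hϖ hne₁ hB
  obtain ⟨d, hd⟩ := ENat.ne_top_iff_exists.mp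
    (kuriharaPartialInfty_ne_top_of_kuriharaPartial_one_ne_top W 3 D.f hne)
  refine ⟨padicValNat 3 W.shaOrder + d, d, ?_, hd.symm, ?_⟩
  · rw [← hid, ← hd]
    push_cast
    rfl
  · rw [Nat.cast_add]
    linarith

end Three

/-! ## §3 Tower-free re-export of p257102 §1 -/

section TowerFree

variable {W : WeierstrassCurve ℚ} [W.IsElliptic] [W.IsGloballyMinimal] {p : ℕ} [hp : Fact p.Prime]

/-- **p257102 §1 without the tower binder** (X4(M), `p ≥ 5`, surj, `r_an = 1`, p07's
`MultBranchUnitCertificateAt`): the tower of `E` from surj(p) by `ClassX4M.towerSurj_of_surj`.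
[cite: Kim2022StructureSelmer, Thm. 1.9 (6) (PDF p. 8)] [cite: Kato2004Asterisque, Thm. 17.4 (3) (p. 273)]
[cite: Delbourgo2002, Theorem (B) (p. 40)] -/
theorem ClassX4M.kuriharaGap_identity_rankOne_of_kim2026_of_katoHalf_of_multCert_of_five_le'
    (hE73 : Kim2026.kuriharaPartial_vanishingOrder_eq_padicValNat_sha_add_partialInfty_of_maninConstant)
    (hKato : Wuthrich2014.kato_halfEigenCharIdeal_dvd_cyclotomicPrime_of_surjective)
    (hmodD : nonempty_modularParametrizationData)
    (hGZK : rank_eq_analyticRank_of_analyticRank_le_one) (hmod : hasEntireLFunction_rat)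
    (hX : ClassX4M W p) (hp5 : 5 ≤ p) (hsurj : Surj W p)
    (hr : W.analyticRank = 1) (hcert : MultBranchUnitCertificateAt W p)
    {Dh : PAdicHeightData W p} (hB : LeadingTermClauses W p Dh)
    {N : ℕ} [NeZero N] (D : ModularParametrizationData W N) (hc : ¬ (p : ℤ) ∣ D.maninConstant)
    (hper : ∃ u : ℚ, ‖(u : ℚ_[p])‖ = 1 ∧ W.realPeriodRat = u * plusPeriod D.f)
    (hne : kuriharaPartial W p D.f 1 ≠ ⊤) :
    ∃ m d : ℕ, kuriharaPartial W p D.f 1 = m ∧ kuriharaPartialInfty W p D.f = d ∧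
      (m : ℤ) - d + (padicRegulator Dh).valuation + padicValNat p W.tamagawaProduct =
        1 + 2 * padicValNat p W.torsionOrder :=
  hX.kuriharaGap_identity_rankOne_of_kim2026_of_katoHalf_of_multCert_of_five_le hE73 hKato hmodD hGZK hmod
    hp5 hsurj (hX.towerSurj_of_surj hsurj) hr hcert hB D hc hper hne

end TowerFree

end Summit.BirchSwinnertonDyer.Rank1Residual.AdditivePotMult

end
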